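import Summits.MatrixMultiplication.MatrixMultiplication.Theses.FourierTwoFamiliesModP
import Literature.Computability.AlgebraicComplexity.SimultaneousDoubleProduct

/-!
# `FourierTwoFamiliesModP.PowerGainRefutes` (stmt-MatrixMultiplication-14312) — proved

The route's kill link: a fixed power saving for balanced SDPP configurations in prime cyclic groups
(`PrimeCyclicPowerGain`: `n · s^{1+c} ≤ p` whenever `n` pairs `(A_i, B_i)` of `s`-subsets of `ℤ/p`,
`s ≥ s₀`, satisfy (W) and (X)) refutes the prime-cyclic two-families conjecture `PrimeTwoFamilies`
(CKSU 2005 Conj. 4.7 with hosts `ℤ/p`: for every `δ > 0` and arbitrarily large `n`, a prime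
`p ≤ n^{2+δ}` and `n` SDPP pairs with `|A_i||B_i| ≥ n^{2-δ}`).

Proof (pure bookkeeping, as in the route card).  Given the gain constants `c, s₀`, take the slice
`δ := c / (2(3+2c))` (so `c - δ(3+2c) = c/2` and `δ < 1/4`) and a witness with `n` large.  All sets are
non-empty (`|A_i||B_i| ≥ n^{2-δ} > 0`), so pairwise disjointness (tree: `IsSDPP.sum_card_left_le`,
`IsSDPP.sum_card_right_le`) gives the packings `Σ|A_i| ≤ p`, `Σ|B_i| ≤ p`.  Markov twice
(`four_mul_card_filter_le`) leaves `m ≥ n/2` "good" indices with `|A_i|·n ≤ 4p` and `|B_i|·n ≤ 4p`,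
whence `|A_i|, |B_i| ≥ n^{2-δ}·n/(4p) ≥ n^{1-2δ}/4`; put `s := ⌈n^{1-2δ}/4⌉ ≥ s₀`.  Shrink the good pairs
to size exactly `s` (`Finset.exists_subset_card_eq`, `IsSDPP.mono`) after reindexing them by `Fin m`
(`IsSDPP.reindex`), and apply the gain: `(n/2)·(n^{1-2δ}/4)^{1+c} ≤ m·s^{1+c} ≤ p ≤ n^{2+δ}`, i.e.
`n^{c/2} ≤ 2·4^{1+c}` — false for `n` large.

Adapted from the candidate proof attached to the item by the crux disprover of
stmt-MatrixMultiplication-14308 (`Cruxes/PrimeTwoFamilies/Disproof.lean` §3c, evidence `PGR.lean`).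
-/

namespace Summit.MatrixMultiplication.MatrixMultiplication.Theorems

open Finset
open Summit.MatrixMultiplication.MatrixMultiplication.Theses
open Literature.Computability.AlgebraicComplexity

/-- Markov on a packing: if `Σ_i f i ≤ p` then at most `n/4` indices `i : Fin n` have
`4p < f i · n` (precisely `4 · #{i : 4p < f i · n} ≤ n`). [folklore] -/
theorem powerGainRefutes_four_mul_card_filter_le {n p : ℕ} (f : Fin n → ℕ) (hf : ∑ i, f i ≤ p) :
    4 * ((Finset.univ : Finset (Fin n)).filter (fun i => 4 * p < f i * n)).card ≤ n := by
  classical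
  set bad := (Finset.univ : Finset (Fin n)).filter (fun i => 4 * p < f i * n) with hbad
  by_cases hb : bad.card = 0
  · rw [hb]; omega
  · -- `#bad · 4p < Σ_{bad} f i · n ≤ p · n`
    have h1 : bad.card * (4 * p) < ∑ i ∈ bad, f i * n := by
      have h2 : ∑ _i ∈ bad, 4 * p < ∑ i ∈ bad, f i * n :=
        Finset.sum_lt_sum_of_nonempty (Finset.card_pos.1 (Nat.pos_of_ne_zero hb))
          fun i hi => (Finset.mem_filter.1 hi).2
      rwa [Finset.sum_const, smul_eq_mul] at h2
    have h3 : ∑ i ∈ bad, f i * n ≤ p * n := by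
      rw [← Finset.sum_mul]
      exact Nat.mul_le_mul_right _ ((Finset.sum_le_sum_of_subset (Finset.filter_subset _ _)).trans hf)
    have h4 : bad.card * (4 * p) < p * n := h1.trans_le h3
    have hp : 0 < p := by
      rcases Nat.eq_zero_or_pos p with h0 | h0
      · rw [h0] at h4; simp at h4
      · exact h0
    have : 4 * bad.card < n := by
      by_contra hcon
      push Not at hcon
      have : p * n ≤ bad.card * (4 * p) := by nlinarith
      omega
    omega

/-- **The kill link `PowerGainRefutes`** (item `stmt-MatrixMultiplication-14312`):
`PrimeCyclicPowerGain → ¬ PrimeTwoFamilies` — a fixed power saving `n·s^{1+c} ≤ p` for balanced SDPP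
configurations in `ℤ/p` refutes the prime-cyclic two-families conjecture.  Bookkeeping: slice
`δ := c/(2(3+2c))`; Markov on the packings `Σ|Aᵢ|, Σ|Bᵢ| ≤ p` leaves `≥ n/2` indices with
`|Aᵢ|·n, |Bᵢ|·n ≤ 4p`, there `|Aᵢ|, |Bᵢ| ≥ n^{1-2δ}/4`; shrink (`IsSDPP.mono`), reindex
(`IsSDPP.reindex`), apply the gain: `n^{c/2} ≤ 2·4^{1+c}`, false for `n` large. [folklore] -/
theorem PowerGainRefutes_proof : FourierTwoFamiliesModP.PowerGainRefutes := by
  unfold FourierTwoFamiliesModP.PowerGainRefutes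
  intro hPG hT
  obtain ⟨c, hc, s₀, hgain⟩ := hPG
  -- the slice
  set δ : ℝ := c / (2 * (3 + 2 * c)) with hδ
  have h32 : 0 < 3 + 2 * c := by linarith
  have hδpos : 0 < δ := by positivity
  have hδE : c - δ * (3 + 2 * c) = c / 2 := by rw [hδ]; field_simp; ring
  have hδ14 : δ < 1 / 4 := by
    rw [hδ, div_lt_iff₀ (by positivity)]; nlinarith
  have h12δ : 0 < 1 - 2 * δ := by linarith
  -- the constant to beat and the level
  set C : ℝ := 2 * (4 : ℝ) ^ (1 + c) with hC
  have hCpos : 0 < C := by positivity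
  set T₁ : ℕ := ⌈C ^ (1 / (c / 2))⌉₊ with hT₁
  set T₂ : ℕ := ⌈((4 : ℝ) * (s₀ + 1)) ^ (1 / (1 - 2 * δ))⌉₊ with hT₂
  obtain ⟨n, hn, p, hp, A, B, hW, hX, hpn, hAB⟩ := hT δ hδpos (T₁ + T₂ + 2)
  have hnpos : (0 : ℝ) < n := by exact_mod_cast (show 0 < n by omega)
  -- `C < n^{c/2}` and `4(s₀+1) < n^{1-2δ}`
  have hbigC : C < (n : ℝ) ^ (c / 2) := by
    have h1 := Nat.le_ceil (C ^ (1 / (c / 2)))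
    have h2 : (T₁ : ℝ) < n := by exact_mod_cast (show T₁ < n by omega)
    have h3 : C ^ (1 / (c / 2)) < n := by rw [hT₁] at h2; linarith
    have h4 := Real.rpow_lt_rpow (Real.rpow_nonneg hCpos.le _) h3 (by positivity : 0 < c / 2)
    rwa [← Real.rpow_mul hCpos.le, one_div_mul_cancel (by positivity), Real.rpow_one] at h4
  have hbigS : (4 : ℝ) * (s₀ + 1) < (n : ℝ) ^ (1 - 2 * δ) := by
    have h0 : (0 : ℝ) ≤ 4 * (s₀ + 1) := by positivity
    have h1 := Nat.le_ceil (((4 : ℝ) * (s₀ + 1)) ^ (1 / (1 - 2 * δ)))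
    have h2 : (T₂ : ℝ) < n := by exact_mod_cast (show T₂ < n by omega)
    have h3 : ((4 : ℝ) * (s₀ + 1)) ^ (1 / (1 - 2 * δ)) < n := by rw [hT₂] at h2; linarith
    have h4 := Real.rpow_lt_rpow (Real.rpow_nonneg h0 _) h3 h12δ
    rwa [← Real.rpow_mul h0, one_div_mul_cancel h12δ.ne', Real.rpow_one] at h4
  haveI : Fact p.Prime := ⟨hp⟩
  have hS : IsSDPP A B := ⟨hW, hX⟩
  -- non-emptiness and the packings `Σ|Aᵢ| ≤ p`, `Σ|Bᵢ| ≤ p`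
  have hY : 0 < (n : ℝ) ^ (2 - δ) := Real.rpow_pos_of_pos hnpos _
  have hne : ∀ i : Fin n, (A i).Nonempty ∧ (B i).Nonempty := by
    intro i
    have h1 : 0 < (A i).card * (B i).card := by
      have : (0 : ℝ) < (((A i).card * (B i).card : ℕ) : ℝ) := hY.trans_le (hAB i)
      exact_mod_cast this
    refine ⟨Finset.card_pos.1 (Nat.pos_of_ne_zero fun h0 => ?_),
      Finset.card_pos.1 (Nat.pos_of_ne_zero fun h0 => ?_)⟩
    · rw [h0, zero_mul] at h1; exact lt_irrefl 0 h1
    · rw [h0, mul_zero] at h1; exact lt_irrefl 0 h1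
  have hsumA : ∑ i, (A i).card ≤ p := by
    have := hS.sum_card_left_le fun i => (hne i).2
    rwa [ZMod.card] at this
  have hsumB : ∑ i, (B i).card ≤ p := by
    have := hS.sum_card_right_le fun i => (hne i).1
    rwa [ZMod.card] at this
  -- the good indices
  classical
  set good := (Finset.univ : Finset (Fin n)).filter
    (fun i => (A i).card * n ≤ 4 * p ∧ (B i).card * n ≤ 4 * p) with hgood
  have hbadA := powerGainRefutes_four_mul_card_filter_le (fun i => (A i).card) hsumA
  have hbadB := powerGainRefutes_four_mul_card_filter_le (fun i => (B i).card) hsumB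
  have hgood_card : n ≤ 2 * good.card := by
    -- complement of good ⊆ badA ∪ badB
    have hsub : (Finset.univ : Finset (Fin n)) ⊆ good ∪
        ((Finset.univ : Finset (Fin n)).filter (fun i => 4 * p < (A i).card * n) ∪
         (Finset.univ : Finset (Fin n)).filter (fun i => 4 * p < (B i).card * n)) := by
      intro i _
      by_cases hA : (A i).card * n ≤ 4 * p
      · by_cases hB : (B i).card * n ≤ 4 * p
        · exact Finset.mem_union_left _ (Finset.mem_filter.2 ⟨Finset.mem_univ _, hA, hB⟩)
        · exact Finset.mem_union_right _ (Finset.mem_union_right _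
            (Finset.mem_filter.2 ⟨Finset.mem_univ _, not_le.1 hB⟩))
      · exact Finset.mem_union_right _ (Finset.mem_union_left _
          (Finset.mem_filter.2 ⟨Finset.mem_univ _, not_le.1 hA⟩))
    have h1 := Finset.card_le_card hsub
    rw [Finset.card_univ, Fintype.card_fin] at h1
    have h2 : (good ∪
        ((Finset.univ : Finset (Fin n)).filter (fun i => 4 * p < (A i).card * n) ∪
         (Finset.univ : Finset (Fin n)).filter (fun i => 4 * p < (B i).card * n))).card ≤
        good.card + (((Finset.univ : Finset (Fin n)).filter (fun i => 4 * p < (A i).card * n)).card +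
          ((Finset.univ : Finset (Fin n)).filter (fun i => 4 * p < (B i).card * n)).card) :=
      (Finset.card_union_le _ _).trans (Nat.add_le_add_left (Finset.card_union_le _ _) _)
    have h3 := h1.trans h2
    omega
  -- sizes on good indices: `|Aᵢ|, |Bᵢ| ≥ n^{1-2δ}/4`
  set s : ℕ := ⌈(n : ℝ) ^ (1 - 2 * δ) / 4⌉₊ with hs_def
  have hs_low : (n : ℝ) ^ (1 - 2 * δ) / 4 ≤ s := Nat.le_ceil _
  have hs₀ : s₀ ≤ s := by
    have : (s₀ : ℝ) < s := by
      have : (s₀ : ℝ) + 1 < (n : ℝ) ^ (1 - 2 * δ) / 4 := by linarith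
      linarith
    exact_mod_cast this.le
  have hkey : ∀ i ∈ good, s ≤ (A i).card ∧ s ≤ (B i).card := by
    intro i hi
    obtain ⟨-, hA4, hB4⟩ := Finset.mem_filter.1 hi
    have hA4r : ((A i).card : ℝ) * n ≤ 4 * p := by exact_mod_cast hA4
    have hB4r : ((B i).card : ℝ) * n ≤ 4 * p := by exact_mod_cast hB4
    have hprod : (n : ℝ) ^ (2 - δ) ≤ ((A i).card : ℝ) * ((B i).card : ℝ) := by
      have := hAB i; push_cast at this; exact this
    have hp4 : (4 : ℝ) * p ≤ 4 * (n : ℝ) ^ (2 + δ) := by linarith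
    -- `|B i| · 4 n^{2+δ} ≥ |B i| · |A i| · n ≥ n^{2-δ} · n`, so `|B i| ≥ n^{1-2δ}/4`
    have e1 : (n : ℝ) ^ (2 - δ) * n = (n : ℝ) ^ (1 - 2 * δ) * (n : ℝ) ^ (2 + δ) := by
      rw [← Real.rpow_add hnpos, show (1 - 2 * δ + (2 + δ) : ℝ) = (2 - δ) + 1 by ring,
        Real.rpow_add hnpos, Real.rpow_one]
    have hpow : 0 < (n : ℝ) ^ (2 + δ) := Real.rpow_pos_of_pos hnpos _
    have hBlow : (n : ℝ) ^ (1 - 2 * δ) / 4 ≤ (B i).card := by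
      have h1 : (n : ℝ) ^ (2 - δ) * n ≤ ((B i).card : ℝ) * (4 * (n : ℝ) ^ (2 + δ)) := by
        calc (n : ℝ) ^ (2 - δ) * n ≤ ((A i).card : ℝ) * ((B i).card : ℝ) * n :=
              mul_le_mul_of_nonneg_right hprod hnpos.le
          _ = ((B i).card : ℝ) * (((A i).card : ℝ) * n) := by ring
          _ ≤ ((B i).card : ℝ) * (4 * p) := mul_le_mul_of_nonneg_left hA4r (Nat.cast_nonneg _)
          _ ≤ ((B i).card : ℝ) * (4 * (n : ℝ) ^ (2 + δ)) :=
              mul_le_mul_of_nonneg_left hp4 (Nat.cast_nonneg _)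
      rw [e1] at h1
      rw [div_le_iff₀ (by norm_num : (0 : ℝ) < 4)]
      have h2 : (n : ℝ) ^ (1 - 2 * δ) * (n : ℝ) ^ (2 + δ) ≤
          (((B i).card : ℝ) * 4) * (n : ℝ) ^ (2 + δ) := by
        linarith
      exact le_of_mul_le_mul_right h2 hpow
    have hAlow : (n : ℝ) ^ (1 - 2 * δ) / 4 ≤ (A i).card := by
      have h1 : (n : ℝ) ^ (2 - δ) * n ≤ ((A i).card : ℝ) * (4 * (n : ℝ) ^ (2 + δ)) := by
        calc (n : ℝ) ^ (2 - δ) * n ≤ ((A i).card : ℝ) * ((B i).card : ℝ) * n :=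
              mul_le_mul_of_nonneg_right hprod hnpos.le
          _ = ((A i).card : ℝ) * (((B i).card : ℝ) * n) := by ring
          _ ≤ ((A i).card : ℝ) * (4 * p) := mul_le_mul_of_nonneg_left hB4r (Nat.cast_nonneg _)
          _ ≤ ((A i).card : ℝ) * (4 * (n : ℝ) ^ (2 + δ)) :=
              mul_le_mul_of_nonneg_left hp4 (Nat.cast_nonneg _)
      rw [e1] at h1
      rw [div_le_iff₀ (by norm_num : (0 : ℝ) < 4)]
      have h2 : (n : ℝ) ^ (1 - 2 * δ) * (n : ℝ) ^ (2 + δ) ≤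
          (((A i).card : ℝ) * 4) * (n : ℝ) ^ (2 + δ) := by
        linarith
      exact le_of_mul_le_mul_right h2 hpow
    exact ⟨Nat.ceil_le.2 hAlow, Nat.ceil_le.2 hBlow⟩
  -- reindex the good pairs by `Fin m` and shrink them to size `s`
  set m : ℕ := good.card with hm
  let ι : Fin m → Fin n := fun j => (good.equivFin.symm j).1
  have hιmem : ∀ j, ι j ∈ good := fun j => (good.equivFin.symm j).2
  have hιinj : Function.Injective ι := by
    intro j j' h
    exact good.equivFin.symm.injective (Subtype.ext h)
  have hA' : ∀ j : Fin m, ∃ A' : Finset (ZMod p), A' ⊆ A (ι j) ∧ A'.card = s :=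
    fun j => Finset.exists_subset_card_eq (hkey _ (hιmem j)).1
  have hB' : ∀ j : Fin m, ∃ B' : Finset (ZMod p), B' ⊆ B (ι j) ∧ B'.card = s :=
    fun j => Finset.exists_subset_card_eq (hkey _ (hιmem j)).2
  choose A' hA'sub hA'card using hA'
  choose B' hB'sub hB'card using hB'
  have hS' : IsSDPP A' B' := (hS.reindex ι hιinj).mono hA'sub hB'sub
  -- the power gain
  have hgain' := hgain p hp m s A' B' hs₀ (fun j => ⟨hA'card j, hB'card j⟩) hS'.1 hS'.2
  -- numerics: `(n/2) · (n^{1-2δ}/4)^{1+c} ≤ m s^{1+c} ≤ p ≤ n^{2+δ}`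
  have hm2 : (n : ℝ) ≤ 2 * m := by exact_mod_cast hgood_card
  have hspos : (0 : ℝ) < (n : ℝ) ^ (1 - 2 * δ) / 4 := by positivity
  have h1 : ((n : ℝ) ^ (1 - 2 * δ) / 4) ^ (1 + c) ≤ (s : ℝ) ^ (1 + c) :=
    Real.rpow_le_rpow hspos.le hs_low (by linarith)
  have h2 : ((n : ℝ) ^ (1 - 2 * δ) / 4) ^ (1 + c) =
      (n : ℝ) ^ ((1 - 2 * δ) * (1 + c)) / (4 : ℝ) ^ (1 + c) := by
    rw [Real.div_rpow (Real.rpow_nonneg hnpos.le _) (by norm_num), ← Real.rpow_mul hnpos.le]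
  have h3 : (n : ℝ) / 2 * ((n : ℝ) ^ ((1 - 2 * δ) * (1 + c)) / (4 : ℝ) ^ (1 + c)) ≤
      (n : ℝ) ^ (2 + δ) := by
    calc (n : ℝ) / 2 * ((n : ℝ) ^ ((1 - 2 * δ) * (1 + c)) / (4 : ℝ) ^ (1 + c))
        ≤ (m : ℝ) * (s : ℝ) ^ (1 + c) := by
          rw [← h2]
          exact mul_le_mul (by linarith) h1 (Real.rpow_nonneg hspos.le _) (Nat.cast_nonneg _)
      _ ≤ p := hgain'
      _ ≤ (n : ℝ) ^ (2 + δ) := hpn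
  -- rewrite as `n^{c/2} ≤ C`
  have h4pos : (0 : ℝ) < (4 : ℝ) ^ (1 + c) := by positivity
  have h4 : (n : ℝ) * (n : ℝ) ^ ((1 - 2 * δ) * (1 + c)) ≤ C * (n : ℝ) ^ (2 + δ) := by
    have h6 := mul_le_mul_of_nonneg_left h3 (show (0 : ℝ) ≤ 2 * (4 : ℝ) ^ (1 + c) by positivity)
    have e : 2 * (4 : ℝ) ^ (1 + c) *
        ((n : ℝ) / 2 * ((n : ℝ) ^ ((1 - 2 * δ) * (1 + c)) / (4 : ℝ) ^ (1 + c))) =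
        (n : ℝ) * (n : ℝ) ^ ((1 - 2 * δ) * (1 + c)) := by
      field_simp
    rw [e] at h6
    rw [hC]
    exact h6
  have e2 : (n : ℝ) * (n : ℝ) ^ ((1 - 2 * δ) * (1 + c)) =
      (n : ℝ) ^ (c / 2) * (n : ℝ) ^ (2 + δ) := by
    rw [← Real.rpow_add hnpos, ← hδE]
    have e3 : (n : ℝ) * (n : ℝ) ^ ((1 - 2 * δ) * (1 + c)) =
        (n : ℝ) ^ (1 + (1 - 2 * δ) * (1 + c)) := by
      rw [Real.rpow_add hnpos, Real.rpow_one]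
    rw [e3]
    congr 1; ring
  rw [e2] at h4
  have h5 : (n : ℝ) ^ (c / 2) ≤ C := le_of_mul_le_mul_right h4 (Real.rpow_pos_of_pos hnpos _)
  linarith

end Summit.MatrixMultiplication.MatrixMultiplication.Theorems
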